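import Summits.MatrixMultiplication.MatrixMultiplication.Theses.TetrahedronCarving
import Summits.MatrixMultiplication.MatrixMultiplication.Theorems.SesquiTensorCut
import HarnessLib

/-!
# TetrahedronCarvingSesquiResidualIff — ERRATUM to the spoke/rim family record: the residual is
RIGID below the cone, `SesquiNoSaving ⟺ TetraNoSaving`

(decomp-mm lens 6 «barrier-complement carving», generation 16; corrects the generation-15 node text
«the residual WEAKENS along `u = 1 → 3/2 → 2`, `TetraNoSaving ⟹ SesquiNoSaving ⟹ ConeNoSaving`,
first implication presumably strict» (module docstring of `Theorems.SesquiTensor`, items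
`stmt-MatrixMultiplication-27190/27191` of route `TetrahedronCarving`, critic note STATUS l.705 with the
"separating world" `(ω, Ω, ω(K₄)) = (2.2, 11, 4.2)`). That world is INCONSISTENT with the tree: the
Kronecker cover `Ω ≤ ω(K₄) + ω(W)` (`omegaSesqui_le_omegaTetra_add_omegaCone`) and the triangle cover of
the cone `ω(W) ≤ 3ω` (`omegaCone_le_three_mul_omega`) give `Ω ≤ ω(K₄) + 3ω` — i.e. `11 ≤ 4.2 + 6.6 =
10.8`, false — and in general `5ω ≤ Ω ⟹ 2ω ≤ ω(K₄)`: **`SesquiNoSaving ⟹ TetraNoSaving`**. Together with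
the rim cover `3·ω(K₄) ≤ ω + Ω` (`three_mul_omegaTetra_le_omega_add_omegaSesqui`, the landed direction
`sesquiNoSaving_of_tetraNoSaving`) the two residuals are EQUIVALENT over every field, and quantitatively the
two savings `s_T := 2ω − ω(K₄) ≥ 0` and `s_S := 5ω − Ω ≥ 0` control each other: `s_T ≤ s_S ≤ 3·s_T`.

CONSEQUENCES FOR THE RECORD. (1) The banked aside `SesquiNoSaving` (item 27190) is, modulo tree
theorems, the declared residual `TetraNoSaving` (item 33478) itself — not a weaker statement; the
u = 3/2 carving `SesquiFlat ∧ SesquiNoSaving` re-cuts ONLY the attacked side (`ConeFlat ⟹ SesquiFlat`,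
`SesquiFlat ∧ … ⟹ TetraFlat`-type comparisons stand). (2) The same two covers show, for every member
`T_{(s,r)} = T_f(K₄)`, `f = (nˢ,nˢ,nˢ,nʳ,nʳ,nʳ)` with `r ≤ s < 2r`, that its residual `(s+r)ω ≤ Ω(s,r)` is
equivalent to `TetraNoSaving` (decompose `f = (2r−s)·(1,…,1) + (s−r)·(2,2,2,1,1,1)`, so `Ω(s,r) ≤
(2r−s)ω(K₄) + (s−r)·3ω`, and conversely `s·ω(K₄) ≤ Ω(s,r) + (s−r)ω` by the rim cover); only the cone
`s = 2r` drops to the (as far as the tree knows) weaker `ConeNoSaving`. In the tree only `(s,r) = (3,2)`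
(`omegaSesqui`) and `(2,1)` (`omegaCone`) are defined, so (2) is certified here for the sesqui member and
recorded as text for the rest. (3) Hence inside the whole weighted-`K₄` family the residual side offers
exactly TWO statements, `TetraNoSaving` and `ConeNoSaving`; further residual re-cuts in the family are moot.

Everything is order arithmetic over landed theorems of `Theorems.SesquiTensor` / `Theorems.ConeTensor` /
`Theorems.TetrahedronTensor`; no `sorry`, no new axiom, no instance, no notation, no definition.
-/

noncomputable section

set_option linter.dupNamespace false

open Summit.MatrixMultiplication.MatrixMultiplication.Theses.TetrahedronCarving
open Summit.MatrixMultiplication.MatrixMultiplication.Theorems.TetrahedronTensor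
open Summit.MatrixMultiplication.MatrixMultiplication.Theorems.ConeTensor
open Summit.MatrixMultiplication.MatrixMultiplication.Theorems.SesquiTensor
open Literature.Computability.AlgebraicComplexity

namespace Summit.MatrixMultiplication.MatrixMultiplication.Theorems.TetrahedronCarvingSesquiResidualIff

section EveryField

variable (F : Type*) [Field F]

/-- **`SesquiNoSaving ⟹ TetraNoSaving`**, every field: `5ω ≤ Ω` and `Ω ≤ ω(K₄) + ω(W) ≤ ω(K₄) + 3ω`
give `2ω ≤ ω(K₄)` (the direction missing from the generation-15 record). [folklore] -/
theorem tetraNoSaving_of_sesquiNoSaving (h : 5 * omega F ≤ omegaSesqui F) :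
    2 * omega F ≤ omegaTetra F := by
  have h₁ := (omegaSesqui_sub_le F).2
  linarith

/-- **The residual is rigid below the cone: `SesquiNoSaving ⟺ TetraNoSaving`** (`5ω ≤ Ω ↔ 2ω ≤ ω(K₄)`),
every field. [folklore] -/
theorem sesquiNoSaving_iff_tetraNoSaving :
    5 * omega F ≤ omegaSesqui F ↔ 2 * omega F ≤ omegaTetra F :=
  ⟨tetraNoSaving_of_sesquiNoSaving F, sesquiNoSaving_of_tetraNoSaving F⟩

/-- Equivalently, in the exact form of both residuals: `Ω = 5ω ↔ ω(K₄) = 2ω`, every field. [folklore] -/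
theorem omegaSesqui_eq_iff_omegaTetra_eq :
    omegaSesqui F = 5 * omega F ↔ omegaTetra F = 2 * omega F := by
  have hS := omegaSesqui_le_five_mul_omega F
  have hT := omegaTetra_le_two_mul_omega F
  constructor
  · intro h
    exact le_antisymm hT (tetraNoSaving_of_sesquiNoSaving F (le_of_eq h.symm))
  · intro h
    exact le_antisymm hS (sesquiNoSaving_of_tetraNoSaving F (le_of_eq h.symm))

/-- **The two savings control each other, lower side: `2ω − ω(K₄) ≤ 5ω − Ω`** (from `Ω ≤ ω(K₄) + 3ω`),
every field. [folklore] -/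
theorem tetraSaving_le_sesquiSaving :
    2 * omega F - omegaTetra F ≤ 5 * omega F - omegaSesqui F := by
  have h₁ := (omegaSesqui_sub_le F).2
  linarith

/-- **Upper side: `5ω − Ω ≤ 3·(2ω − ω(K₄))`** (from the rim cover `3·ω(K₄) ≤ ω + Ω`), every field; so the
sesqui saving vanishes iff the tetrahedron saving does, with the explicit window
`s_T ≤ s_S ≤ 3 s_T`. [folklore] -/
theorem sesquiSaving_le_three_mul_tetraSaving :
    5 * omega F - omegaSesqui F ≤ 3 * (2 * omega F - omegaTetra F) := by
  have h₁ := three_mul_omegaTetra_le_omega_add_omegaSesqui F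
  linarith

/-- Both savings are nonnegative (the covers `ω(K₄) ≤ 2ω`, `Ω ≤ 5ω`), every field. [folklore] -/
theorem savings_nonneg :
    0 ≤ 2 * omega F - omegaTetra F ∧ 0 ≤ 5 * omega F - omegaSesqui F := by
  have hT := omegaTetra_le_two_mul_omega F
  have hS := omegaSesqui_le_five_mul_omega F
  constructor <;> linarith

/-- **The critic's separating world is inconsistent**: no field has `Ω > ω(K₄) + 3ω`; in particular
`(ω, Ω, ω(K₄)) = (2.2, 11, 4.2)` (`11 > 10.8`) is impossible. [folklore] -/
theorem omegaSesqui_le_omegaTetra_add_three_mul_omega :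
    omegaSesqui F ≤ omegaTetra F + 3 * omega F := by
  have h₁ := (omegaSesqui_sub_le F).2
  linarith

/-- The numerical instance: the exponent triple `(2.2, 11, 4.2)` cannot occur over any field. [folklore] -/
theorem not_world_22_11_42 :
    ¬ (omega F = 2.2 ∧ omegaSesqui F = 11 ∧ omegaTetra F = 4.2) := by
  rintro ⟨hω, hΩ, hK⟩
  have h := omegaSesqui_le_omegaTetra_add_three_mul_omega F
  rw [hω, hΩ, hK] at h
  norm_num at h

/-- **The complete comparison map of the spoke/rim family's residuals in the tree**:
`TetraNoSaving ⟺ SesquiNoSaving ⟹ ConeNoSaving`, every field. [folklore] -/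
theorem residual_map :
    (2 * omega F ≤ omegaTetra F ↔ 5 * omega F ≤ omegaSesqui F) ∧
      (5 * omega F ≤ omegaSesqui F → 3 * omega F ≤ omegaCone F) :=
  ⟨(sesquiNoSaving_iff_tetraNoSaving F).symm, coneNoSaving_of_sesquiNoSaving F⟩

end EveryField

/-! ## By name, over `ℂ`: the route items -/

/-- **Items `stmt-MatrixMultiplication-27190` (`SesquiNoSaving`, banked aside) and
`stmt-MatrixMultiplication-33478` (`TetraNoSaving`, the declared residual) are EQUIVALENT** modulo the
tree. [folklore] -/
theorem sesquiNoSaving_iff_tetraNoSaving_items : SesquiNoSaving ↔ TetraNoSaving :=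
  sesquiNoSaving_iff_tetraNoSaving ℂ

/-- The missing direction by name, in contrapositive form (a tetrahedron saving IS a sesqui saving):
`¬ TetraNoSaving → ¬ SesquiNoSaving`. [folklore] -/
theorem not_sesquiNoSaving_of_not_tetraNoSaving (h : ¬ TetraNoSaving) : ¬ SesquiNoSaving :=
  fun hS => h (tetraNoSaving_of_sesquiNoSaving ℂ hS)

/-- Hence the u = 3/2 carving has the SAME residual as the route of record: its exact cut reads
`ω(ℂ) = 2 ⟺ SesquiFlat ∧ TetraNoSaving` (from `matrixMultiplication_iff_sesqui` and the rigidity). [folklore] -/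
theorem matrixMultiplication_iff_sesquiFlat_and_tetraNoSaving :
    _root_.MatrixMultiplication ↔ (SesquiFlat ∧ TetraNoSaving) := by
  rw [matrixMultiplication_iff_sesqui]
  show (omegaSesqui ℂ ≤ 10 ∧ 5 * omega ℂ ≤ omegaSesqui ℂ) ↔ (omegaSesqui ℂ ≤ 10 ∧ 2 * omega ℂ ≤ omegaTetra ℂ)
  rw [sesquiNoSaving_iff_tetraNoSaving ℂ]

end Summit.MatrixMultiplication.MatrixMultiplication.Theorems.TetrahedronCarvingSesquiResidualIff

end
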